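import Summits.Parity.GeneralizedHardyLittlewood.Theorems.BeyondDiagonalBeatsQuarter.OffDiagHeartCore
import HarnessLib

/-!
# Route `PrimeLevelFamEdge`, crux K_B (stmt-Parity-20343), line `diagonal_kernel_split` rev 4, plan Ω,
# worker key K2 (part a) `OffDiagCoreLedgerSplit`: the finite dual core `offDiagCore Hf` against the trivial
# ledger — **per box, `‖Σ_{h∈ℤ², |h₁| ≤ H₁} Φ̂_i N‖ ≤ Σ_{|h₁| ≤ H₁, |h₂| ≤ H₂} ‖Φ̂_i‖N + q(r+1)·Σ_{|h₂| > H₂} ‖Φ̂_i‖`,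
# and `|offDiagCore Hf Δ′ q| ≤ (4πq̂/q)·(LEDGER(Hf, H₂f) + TAIL₂(H₂f))` for ANY two height functions**

Ω-h v4 (`OffDiagHeartCore`, p643105) fixed the finite dual core `offDiagCore Hf Δ′ q`: the near head with each dual
series restricted to `|h₁| ≤ Hf q d₁ d₂ α β c i`, the second frequency complete. The trivial ledger
(`OffDiagDualLedgerMainScale.dualLedgerTotal_scales_le`) bounds DOUBLY truncated cores. This file is the glue,
with no asymptotics and for arbitrary height functions `Hf` (first frequency) and `H₂f` (second frequency):
* `norm_tsum_trunc_le_box_add_tail` — per box: the norm of the `|h₁| ≤ H₁`-truncated dual series is at most the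
  ledger sum over the box `|h₁| ≤ H₁, |h₂| ≤ H₂` plus `q r` (the trivial multiplicity bound `N ≤ qr`,
  `dualCount_le`) times the `|h₂| > H₂` tail of `‖Φ̂_i‖`;
* **`abs_offDiagCore_le_ledger_add_tail`** — summing over `r < q⁷`, `l, m ≤ q̂^{Δ′}` (`|c_lc_m|`), `d₁∣l, d₂∣m`,
  `i ∈ nearBoxes`, with `‖2q̂(2π/q)‖ = 4πq̂/q`:
  `|offDiagCore Hf Δ′ q| ≤ (4πq̂/q)·(LEDGER + TAIL₂)`, `LEDGER` = the left side of `dualLedgerTotal_le` at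
  `A = (Hf, H₂f)`, `TAIL₂ = Σ … |c_lc_m| Σ_{d,i} q(r+1)·Σ_{h∈ℤ², |h₂| > H₂f} ‖Φ̂_i(h/(q(r+1)))‖` — the shape
  L2's `OffDiagDualTruncationBox.tsum_tail_snd_norm_fourier2_boxWeight_le` bounds box by box.
The same manipulation serves K1's (T) (`nearHead − core` = the `|h₁| > Hf` tails). Bookkeeping; standard axioms.
Helper (`--supports stmt-Parity-20343`).
«The programme SEARCHES and TYPES; no claim about Landau–Siegel zeros, Theorems 1–2 of arXiv:2211.02515 or
a repaired Margin232 until a kernel theorem says so.»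
-/

noncomputable section

open Finset Polynomial
open scoped Real

namespace Summit.Parity.GeneralizedHardyLittlewood.Theorems.BeyondDiagonalBeatsQuarter.OffDiag

open Literature.NumberTheory.LFunctions Literature.NumberTheory.LFunctions.KMV2000
open Literature.NumberTheory.Sieve.FriedlanderIwaniecPrimes (fourier2)
open PeterssonSplit (nearBoxes)

/-! ### §1. One box: truncated series against box ledger plus second-frequency tail -/

section Box

variable {q d₁ d₂ α β : ℕ}

/-- **Per box.** For `q, d₁, d₂, α, β ≥ 1`, modulus `q r ≠ 0`, a box `i` and heights `H₁, H₂`: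
`‖Σ_{h ∈ ℤ², |h₁| ≤ H₁} Φ̂_i(h/(qr))·N_{qr}(α,β;h)‖ ≤ Σ_{|h₁| ≤ H₁, |h₂| ≤ H₂} ‖Φ̂_i(h/(qr))‖·N
  + (qr)·Σ_{h ∈ ℤ², |h₂| > H₂} ‖Φ̂_i(h/(qr))‖` (`N ≤ qr`). [folklore] -/
theorem norm_tsum_trunc_le_box_add_tail [NeZero q] (hd₁ : 1 ≤ d₁) (hd₂ : 1 ≤ d₂) (hα : 1 ≤ α) (hβ : 1 ≤ β)
    (r : ℕ) [NeZero (q * r)] (i : ℕ × ℕ) (H₁ H₂ : ℕ) :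
    ‖∑' h : ℤ × ℤ, (if |h.1| ≤ (H₁ : ℤ) then
        fourier2 (boxWeight q d₁ d₂ α β r i) (h.1 / (q * r : ℕ)) (h.2 / (q * r : ℕ)) *
          (dualCount (q * r) (α : ZMod (q * r)) (β : ZMod (q * r)) (h.1 : ZMod (q * r)) (h.2 : ZMod (q * r)) : ℂ)
        else 0)‖ ≤
      (∑ h ∈ (Finset.Icc (-(H₁ : ℤ)) H₁) ×ˢ (Finset.Icc (-(H₂ : ℤ)) H₂),
          ‖fourier2 (boxWeight q d₁ d₂ α β r i) (h.1 / (q * r : ℕ)) (h.2 / (q * r : ℕ))‖ *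
            (dualCount (q * r) (α : ZMod (q * r)) (β : ZMod (q * r)) (h.1 : ZMod (q * r)) (h.2 : ZMod (q * r)) : ℝ)) +
        ((q * r : ℕ) : ℝ) * ∑' h : ℤ × ℤ, (if (H₂ : ℤ) < |h.2| then
          ‖fourier2 (boxWeight q d₁ d₂ α β r i) (h.1 / (q * r : ℕ)) (h.2 / (q * r : ℕ))‖ else 0) := by
  classical
  set c : ℕ := q * r with hc
  have hc0 : (0 : ℝ) < (c : ℝ) := by exact_mod_cast Nat.pos_of_ne_zero (NeZero.ne (q * r))
  set F : ℤ × ℤ → ℂ := fun h ↦ fourier2 (boxWeight q d₁ d₂ α β r i) (h.1 / (c : ℕ)) (h.2 / (c : ℕ)) with hF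
  set N : ℤ × ℤ → ℕ := fun h ↦
    dualCount c (α : ZMod c) (β : ZMod c) (h.1 : ZMod c) (h.2 : ZMod c) with hN
  set B : Finset (ℤ × ℤ) := (Finset.Icc (-(H₁ : ℤ)) H₁) ×ˢ (Finset.Icc (-(H₂ : ℤ)) H₂) with hB
  -- summability of `‖Φ̂‖` over the lattice
  have hsF : Summable fun h : ℤ × ℤ ↦ ‖F h‖ :=
    (OffDiagPoissonTwisted.summable_fourier2_lattice_of_contDiff
      (contDiff_uncurry_boxWeight (q := q) (r := r) hd₁ hd₂ hα hβ i)
      (hasCompactSupport_uncurry_boxWeight (q := q) (d₁ := d₁) (d₂ := d₂) (α := α) (β := β) (r := r) i)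
      hc0).norm
  have hNle : ∀ h : ℤ × ℤ, ((N h : ℕ) : ℝ) ≤ (c : ℝ) := fun h ↦ by
    exact_mod_cast dualCount_le _ _ _ _
  -- the summand and its two majorants
  set f : ℤ × ℤ → ℂ := fun h ↦ if |h.1| ≤ (H₁ : ℤ) then F h * (N h : ℂ) else 0 with hf
  set g₁ : ℤ × ℤ → ℝ := fun h ↦ if h ∈ B then ‖F h‖ * (N h : ℝ) else 0 with hg₁
  set g₂ : ℤ × ℤ → ℝ := fun h ↦ (c : ℝ) * (if (H₂ : ℤ) < |h.2| then ‖F h‖ else 0) with hg₂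
  have hnormFN : ∀ h : ℤ × ℤ, ‖F h * (N h : ℂ)‖ = ‖F h‖ * (N h : ℝ) := fun h ↦ by
    rw [norm_mul, Complex.norm_natCast]
  have hf_le : ∀ h : ℤ × ℤ, ‖f h‖ ≤ ‖F h‖ * (c : ℝ) := fun h ↦ by
    simp only [hf]
    split_ifs
    · rw [hnormFN]; exact mul_le_mul_of_nonneg_left (hNle h) (norm_nonneg _)
    · rw [norm_zero]; positivity
  have hsf : Summable fun h : ℤ × ℤ ↦ ‖f h‖ :=
    Summable.of_nonneg_of_le (fun h ↦ norm_nonneg _) hf_le (hsF.mul_right _)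
  have hg₁s : Summable g₁ := by
    refine summable_of_ne_finset_zero (s := B) fun h hh ↦ ?_
    simp only [hg₁, if_neg hh]
  have hg₂s : Summable g₂ := by
    refine (hsF.mul_left (c : ℝ)).of_nonneg_of_le (fun h ↦ by positivity) fun h ↦ ?_
    simp only [hg₂]
    split_ifs
    · exact le_rfl
    · exact mul_le_mul_of_nonneg_left (norm_nonneg _) hc0.le
  have hpt : ∀ h : ℤ × ℤ, ‖f h‖ ≤ g₁ h + g₂ h := by
    intro h
    have hg₁0 : 0 ≤ g₁ h := by simp only [hg₁]; split_ifs <;> positivity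
    have hg₂0 : 0 ≤ g₂ h := by simp only [hg₂]; positivity
    simp only [hf]
    split_ifs with h1
    · rw [hnormFN]
      by_cases h2 : |h.2| ≤ (H₂ : ℤ)
      · have hmem : h ∈ B := by
          rw [hB, Finset.mem_product, Finset.mem_Icc, Finset.mem_Icc]
          exact ⟨abs_le.mp h1, abs_le.mp h2⟩
        have : g₁ h = ‖F h‖ * (N h : ℝ) := by simp only [hg₁, if_pos hmem]
        linarith
      · rw [not_le] at h2
        have : g₂ h = (c : ℝ) * ‖F h‖ := by simp only [hg₂, if_pos h2]
        have hle : ‖F h‖ * (N h : ℝ) ≤ (c : ℝ) * ‖F h‖ := by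
          rw [mul_comm (c : ℝ)]; exact mul_le_mul_of_nonneg_left (hNle h) (norm_nonneg _)
        linarith
    · rw [norm_zero]; positivity
  -- the two majorant sums
  have hsum₁ : ∑' h, g₁ h = ∑ h ∈ B, ‖F h‖ * (N h : ℝ) := by
    rw [tsum_eq_sum (s := B) (fun h hh ↦ by simp only [hg₁, if_neg hh])]
    exact Finset.sum_congr rfl fun h hh ↦ by simp only [hg₁, if_pos hh]
  have hsum₂ : ∑' h, g₂ h = (c : ℝ) * ∑' h : ℤ × ℤ, (if (H₂ : ℤ) < |h.2| then ‖F h‖ else 0) := by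
    simp only [hg₂]; exact tsum_mul_left
  calc ‖∑' h, f h‖ ≤ ∑' h, ‖f h‖ := norm_tsum_le_tsum_norm hsf
    _ ≤ ∑' h, (g₁ h + g₂ h) := hsf.tsum_le_tsum hpt (hg₁s.add hg₂s)
    _ = ∑' h, g₁ h + ∑' h, g₂ h := hg₁s.tsum_add hg₂s
    _ = _ := by rw [hsum₁, hsum₂]

end Box

/-! ### §2. The core against ledger plus tail -/

/-- **`|offDiagCore Hf Δ′ q| ≤ (4πq̂/q)·(LEDGER(Hf,H₂f) + TAIL₂(H₂f))`** for any two height functions (`q ≥ 1`,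
`Δ′` arbitrary): triangle inequality through `r < q⁷`, `l, m` (`|c_lc_m|`), `d₁∣l`, `d₂∣m`, `i ∈ nearBoxes`, and
`norm_tsum_trunc_le_box_add_tail` in each box. [cite: KowalskiMichelVanderKam2000, (21)–(23) p. 12 — derivation] -/
theorem abs_offDiagCore_le_ledger_add_tail {q : ℕ} [NeZero q]
    (Hf H₂f : ℕ → ℕ → ℕ → ℕ → ℕ → ℕ → ℕ × ℕ → ℕ) (Δ' : ℝ) :
    |offDiagCore Hf Δ' q| ≤ 4 * π * qhat q / q *
      (∑ r ∈ Finset.range (q ^ 7), ∑ l ∈ Finset.Icc 1 ⌊qhat q ^ Δ'⌋₊, ∑ m ∈ Finset.Icc 1 ⌊qhat q ^ Δ'⌋₊,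
          |mollifierCoeff (X ^ 2) (qhat q ^ Δ') l * mollifierCoeff (X ^ 2) (qhat q ^ Δ') m| *
            ∑ d₁ ∈ l.divisors, ∑ d₂ ∈ m.divisors, ∑ i ∈ nearBoxes q d₁ d₂ (Real.log q ^ 4),
              ∑ h ∈ (Finset.Icc (-(Hf q d₁ d₂ (l / d₁) (m / d₂) (r + 1) i : ℤ))
                    (Hf q d₁ d₂ (l / d₁) (m / d₂) (r + 1) i)) ×ˢ
                  (Finset.Icc (-(H₂f q d₁ d₂ (l / d₁) (m / d₂) (r + 1) i : ℤ))
                    (H₂f q d₁ d₂ (l / d₁) (m / d₂) (r + 1) i)),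
                ‖fourier2 (boxWeight q d₁ d₂ (l / d₁) (m / d₂) (r + 1) i) (h.1 / (q * (r + 1) : ℕ))
                    (h.2 / (q * (r + 1) : ℕ))‖ *
                  (dualCount (q * (r + 1)) ((l / d₁ : ℕ) : ZMod (q * (r + 1)))
                    ((m / d₂ : ℕ) : ZMod (q * (r + 1))) (h.1 : ZMod (q * (r + 1)))
                    (h.2 : ZMod (q * (r + 1))) : ℝ) +
        ∑ r ∈ Finset.range (q ^ 7), ∑ l ∈ Finset.Icc 1 ⌊qhat q ^ Δ'⌋₊, ∑ m ∈ Finset.Icc 1 ⌊qhat q ^ Δ'⌋₊,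
          |mollifierCoeff (X ^ 2) (qhat q ^ Δ') l * mollifierCoeff (X ^ 2) (qhat q ^ Δ') m| *
            ∑ d₁ ∈ l.divisors, ∑ d₂ ∈ m.divisors, ∑ i ∈ nearBoxes q d₁ d₂ (Real.log q ^ 4),
              ((q * (r + 1) : ℕ) : ℝ) * ∑' h : ℤ × ℤ,
                (if (H₂f q d₁ d₂ (l / d₁) (m / d₂) (r + 1) i : ℤ) < |h.2| then
                  ‖fourier2 (boxWeight q d₁ d₂ (l / d₁) (m / d₂) (r + 1) i) (h.1 / (q * (r + 1) : ℕ))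
                    (h.2 / (q * (r + 1) : ℕ))‖ else 0)) := by
  classical
  unfold offDiagCore
  rw [dif_neg (NeZero.ne q)]
  -- prefactor
  have hpre : ‖(2 * (qhat q : ℂ) * (2 * π / q))‖ = 4 * π * qhat q / q := by
    have hq0 : (0 : ℝ) < q := by exact_mod_cast Nat.pos_of_ne_zero (NeZero.ne q)
    have hs0 : 0 ≤ qhat q := (qhat_pos_of_neZero q).le
    rw [show (2 * (qhat q : ℂ) * (2 * π / q)) = ((4 * π * qhat q / q : ℝ) : ℂ) by push_cast; ring,
      Complex.norm_real, Real.norm_of_nonneg (by positivity)]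
  -- |re z| ≤ ‖z‖, then the norm through the finite sums
  rw [abs_neg]
  refine (Complex.abs_re_le_norm _).trans ?_
  rw [norm_mul, hpre, ← Finset.sum_add_distrib]
  refine mul_le_mul_of_nonneg_left ?_ (by
    have hs0 : 0 ≤ qhat q := (qhat_pos_of_neZero q).le
    positivity)
  refine (norm_sum_le _ _).trans (Finset.sum_le_sum fun r _ ↦ ?_)
  rw [← Finset.sum_add_distrib]
  refine (norm_sum_le _ _).trans (Finset.sum_le_sum fun l hl ↦ ?_)
  rw [← Finset.sum_add_distrib]
  refine (norm_sum_le _ _).trans (Finset.sum_le_sum fun m hm ↦ ?_)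
  rw [norm_mul, ← mul_add, Complex.norm_real, Real.norm_eq_abs]
  refine mul_le_mul_of_nonneg_left ?_ (abs_nonneg _)
  rw [← Finset.sum_add_distrib]
  refine (norm_sum_le _ _).trans (Finset.sum_le_sum fun d₁ hd₁ ↦ ?_)
  rw [← Finset.sum_add_distrib]
  refine (norm_sum_le _ _).trans (Finset.sum_le_sum fun d₂ hd₂ ↦ ?_)
  rw [← Finset.sum_add_distrib]
  refine (norm_sum_le _ _).trans (Finset.sum_le_sum fun i _ ↦ ?_)
  have hl1 : 1 ≤ l := (Finset.mem_Icc.mp hl).1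
  have hm1 : 1 ≤ m := (Finset.mem_Icc.mp hm).1
  exact norm_tsum_trunc_le_box_add_tail (q := q) (Nat.pos_of_mem_divisors hd₁) (Nat.pos_of_mem_divisors hd₂)
    (OffDiagDual.one_le_div_of_dvd (Nat.dvd_of_mem_divisors hd₁) hl1)
    (OffDiagDual.one_le_div_of_dvd (Nat.dvd_of_mem_divisors hd₂) hm1) (r + 1) i _ _

end Summit.Parity.GeneralizedHardyLittlewood.Theorems.BeyondDiagonalBeatsQuarter.OffDiag
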